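import Mathlib
import HarnessLib

/-!
# Hereditary (multiset) terms over `{+, ×}`: syntax, semantics, renaming and a canonical normal form

Route MonotoneRestoration, crux `OrbitRestorationQP` (stmt-ValiantsHypothesis-18293) — K3 machinery, namespace
`Summit.ValiantsHypothesis.ValiantsHypothesis.Theorems.HTerm`.

Support for REDUCED symmetric arithmetic circuits (Dawar–Wilsenach 2025, Def. 2.2 / §3.3: the orbit
size `ORB` counts orbits under ALL automorphisms, so length-free orbit bounds need circuits without
structurally identical gates).  A gate of a `{+, ×}`-circuit with SET-valued wiring is determined, up
to automorphisms fixing everything else, by its hereditary unfolding: a term whose internal nodes carry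
a label `+`/`×` and a MULTISET of sub-terms.  This file provides that term language with LIST children
and a canonical normal form (children recursively sorted along a fixed well-order), so that two
unfoldings are hereditarily AC-equal iff their normal forms coincide.

* `HTerm K X` — `var x | const c | node (isMul : Bool) (args : List (HTerm K X))`;
* `HTerm.val` — the polynomial computed (`Σ` / `Π` of the children, with multiplicity);
* `HTerm.rename σ` — relabelling the variables along a map `X → X`; `val_rename`;
* `HTerm.normalize` — recursive sorting of the children lists along a fixed (classical) linear order
  `termOrder`; `val_normalize`, `normalize_normalize` (idempotent), `normalize_node_perm` (invariance
  under permuting children), `normalize_rename_normalize` (`normalize (rename σ (normalize t)) =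
  normalize (rename σ t)`), and the action `HTerm.act σ t = normalize (rename σ t)` of a group acting on
  `X` on normal forms (`act_one`, `act_mul`);
* `HTerm.size`, `size_lt_of_mem` (children are smaller).

Everything is proved.  References: Dawar–Wilsenach, *Symmetric arithmetic circuits*, ToC 21 (2025),
Def. 2.2, §3.3 [DawarWilsenach2025]; *Symmetric circuits for rank logic*, ACM ToCL 23 (2021/22), §3
(syntactic equivalence, reduced circuits) [DawarWilsenach2021].
-/

noncomputable section

-- `Summit.ValiantsHypothesis.ValiantsHypothesis.…` is the tree's single-conjunct layout (Sub = Summit).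
set_option linter.dupNamespace false

namespace Summit.ValiantsHypothesis.ValiantsHypothesis.Theorems

universe u v

/-- **Hereditary `{+, ×}`-terms** over constants `K` and variables `X`: leaves are variables or
constants, an internal node is a sum (`isMul = false`) or a product (`isMul = true`) of a LIST of
sub-terms (normal forms below make the order irrelevant). [folklore] -/
inductive HTerm (K : Type u) (X : Type v) : Type (max u v)
  /-- A variable leaf. -/
  | var (x : X) : HTerm K X
  /-- A constant leaf. -/
  | const (c : K) : HTerm K X
  /-- An internal node: `isMul = false` a sum, `isMul = true` a product of the listed sub-terms. -/
  | node (isMul : Bool) (args : List (HTerm K X)) : HTerm K X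

namespace HTerm

variable {K : Type u} {X : Type v}

/-! ### Size -/

mutual
/-- The number of nodes of a term. [folklore] -/
def size : HTerm K X → ℕ
  | var _ => 1
  | const _ => 1
  | node _ l => sizeList l + 1
/-- The total size of a list of terms. [folklore] -/
def sizeList : List (HTerm K X) → ℕ
  | [] => 0
  | t :: ts => size t + sizeList ts
end

/-- `sizeList` is the sum of the sizes. [folklore] -/
theorem sizeList_eq_sum (l : List (HTerm K X)) : sizeList l = (l.map size).sum := by
  induction l with
  | nil => rfl
  | cons t ts ih => simp [sizeList, ih]

/-- Every term has positive size. [folklore] -/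
theorem size_pos (t : HTerm K X) : 0 < t.size := by
  cases t <;> simp [size]

/-- A member of a list is no larger than the list. [folklore] -/
theorem size_le_sizeList {l : List (HTerm K X)} {t : HTerm K X} (h : t ∈ l) : t.size ≤ sizeList l := by
  rw [sizeList_eq_sum]
  exact List.single_le_sum (fun _ _ => Nat.zero_le _) _ (List.mem_map_of_mem h)

/-- Children are smaller than their node. [folklore] -/
theorem size_lt_of_mem {b : Bool} {l : List (HTerm K X)} {t : HTerm K X} (h : t ∈ l) :
    t.size < (node b l).size := by
  have := size_le_sizeList h
  simp only [size]
  omega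

/-- Permuting a list of terms does not change its total size. [folklore] -/
theorem sizeList_perm {l l' : List (HTerm K X)} (h : l.Perm l') : sizeList l = sizeList l' := by
  rw [sizeList_eq_sum, sizeList_eq_sum]
  exact (h.map size).sum_eq

/-! ### Semantics -/

section Val

variable [CommSemiring K]

mutual
/-- **The polynomial of a term**: variables and constants, `Σ` of the children of a sum node, `Π` of
the children of a product node (with multiplicity). [folklore] -/
def val : HTerm K X → MvPolynomial X K
  | var x => MvPolynomial.X x
  | const c => MvPolynomial.C c
  | node false l => (valList l).sum
  | node true l => (valList l).prod
/-- The list of polynomials of a list of terms. [folklore] -/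
def valList : List (HTerm K X) → List (MvPolynomial X K)
  | [] => []
  | t :: ts => val t :: valList ts
end

/-- `valList` is `map val`. [folklore] -/
theorem valList_eq_map (l : List (HTerm K X)) : valList l = l.map val := by
  induction l with
  | nil => rfl
  | cons t ts ih => simp [valList, ih]

/-- Value of a variable. [folklore] -/
@[simp] theorem val_var (x : X) : (var x : HTerm K X).val = MvPolynomial.X x := by simp [val]

/-- Value of a constant. [folklore] -/
@[simp] theorem val_const (c : K) : (const c : HTerm K X).val = MvPolynomial.C c := by simp [val]

/-- Value of a sum node. [folklore] -/
theorem val_node_false (l : List (HTerm K X)) : (node false l).val = (l.map val).sum := by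
  rw [val, valList_eq_map]

/-- Value of a product node. [folklore] -/
theorem val_node_true (l : List (HTerm K X)) : (node true l).val = (l.map val).prod := by
  rw [val, valList_eq_map]

/-- The value of a node depends only on the multiset of its children. [folklore] -/
theorem val_node_perm (b : Bool) {l l' : List (HTerm K X)} (h : l.Perm l') :
    (node b l).val = (node b l').val := by
  cases b
  · rw [val_node_false, val_node_false]; exact (h.map val).sum_eq
  · rw [val_node_true, val_node_true]; exact (h.map val).prod_eq

end Val

/-! ### Renaming the variables -/

mutual
/-- Relabelling the variable leaves along `f : X → X`. [folklore] -/
def rename (f : X → X) : HTerm K X → HTerm K X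
  | var x => var (f x)
  | const c => const c
  | node b l => node b (renameList f l)
/-- `rename` on lists. [folklore] -/
def renameList (f : X → X) : List (HTerm K X) → List (HTerm K X)
  | [] => []
  | t :: ts => rename f t :: renameList f ts
end

/-- `renameList` is `map (rename f)`. [folklore] -/
theorem renameList_eq_map (f : X → X) (l : List (HTerm K X)) : renameList f l = l.map (rename f) := by
  induction l with
  | nil => rfl
  | cons t ts ih => simp [renameList, ih]

/-- `rename` of a node. [folklore] -/
theorem rename_node (f : X → X) (b : Bool) (l : List (HTerm K X)) :
    rename f (node b l) = node b (l.map (rename f)) := by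
  rw [rename, renameList_eq_map]

/-- `rename id = id`. [folklore] -/
theorem rename_id : ∀ t : HTerm K X, rename id t = t
  | var x => rfl
  | const c => rfl
  | node b l => by
    rw [rename_node]
    congr 1
    conv_rhs => rw [← List.map_id l]
    exact List.map_congr_left fun t _ => rename_id t

/-- `rename` is functorial. [folklore] -/
theorem rename_comp (f g : X → X) : ∀ t : HTerm K X, rename f (rename g t) = rename (f ∘ g) t
  | var x => rfl
  | const c => rfl
  | node b l => by
    rw [rename_node, rename_node, rename_node, List.map_map]
    congr 1
    exact List.map_congr_left fun t _ => rename_comp f g t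

/-- `rename` preserves size. [folklore] -/
theorem size_rename (f : X → X) : ∀ t : HTerm K X, (rename f t).size = t.size
  | var x => rfl
  | const c => rfl
  | node b l => by
    rw [rename_node, size, size, sizeList_eq_sum, sizeList_eq_sum, List.map_map]
    congr 2
    exact List.map_congr_left fun t _ => size_rename f t

/-- **Semantics of renaming**: `val (rename f t) = MvPolynomial.rename f (val t)`. [folklore] -/
theorem val_rename [CommSemiring K] (f : X → X) :
    ∀ t : HTerm K X, (rename f t).val = MvPolynomial.rename f t.val
  | var x => by simp [rename, val]
  | const c => by simp [rename, val]
  | node b l => by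
    rw [rename_node]
    cases b
    · rw [val_node_false, val_node_false, map_list_sum, List.map_map, List.map_map]
      congr 1
      exact List.map_congr_left fun t _ => val_rename f t
    · rw [val_node_true, val_node_true, map_list_prod, List.map_map, List.map_map]
      congr 1
      exact List.map_congr_left fun t _ => val_rename f t

/-! ### The normal form -/

/-- A fixed linear order on terms (the linear order of a well-ordering of the type; classical).
[folklore] -/
@[reducible] def termOrder (K : Type u) (X : Type v) : LinearOrder (HTerm K X) :=
  IsWellOrder.linearOrder WellOrderingRel

/-- Sorting a list of terms along `termOrder`. [folklore] -/
def tsort (l : List (HTerm K X)) : List (HTerm K X) :=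
  letI := termOrder K X
  l.insertionSort (· ≤ ·)

/-- `tsort l` is a permutation of `l`. [folklore] -/
theorem tsort_perm (l : List (HTerm K X)) : (tsort l).Perm l := by
  letI := termOrder K X
  exact List.perm_insertionSort _ l

/-- `tsort` is invariant under permutations (sorted permutations of each other are equal). [folklore] -/
theorem tsort_eq_of_perm {l l' : List (HTerm K X)} (h : l.Perm l') : tsort l = tsort l' := by
  letI := termOrder K X
  refine List.Perm.eq_of_pairwise' (r := (· ≤ ·)) (List.pairwise_insertionSort _ l)
    (List.pairwise_insertionSort _ l') ?_
  exact ((List.perm_insertionSort _ l).trans h).trans (List.perm_insertionSort _ l').symm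

/-- `tsort` is idempotent. [folklore] -/
theorem tsort_tsort (l : List (HTerm K X)) : tsort (tsort l) = tsort l :=
  tsort_eq_of_perm (tsort_perm l)

mutual
/-- **The normal form**: children lists recursively sorted along `termOrder`. [folklore] -/
def normalize : HTerm K X → HTerm K X
  | var x => var x
  | const c => const c
  | node b l => node b (tsort (normalizeList l))
/-- `normalize` on lists. [folklore] -/
def normalizeList : List (HTerm K X) → List (HTerm K X)
  | [] => []
  | t :: ts => normalize t :: normalizeList ts
end

/-- `normalizeList` is `map normalize`. [folklore] -/
theorem normalizeList_eq_map (l : List (HTerm K X)) : normalizeList l = l.map normalize := by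
  induction l with
  | nil => rfl
  | cons t ts ih => simp [normalizeList, ih]

/-- Normal form of a node. [folklore] -/
theorem normalize_node (b : Bool) (l : List (HTerm K X)) :
    normalize (node b l) = node b (tsort (l.map normalize)) := by
  rw [normalize, normalizeList_eq_map]

/-- Normal form of a variable. [folklore] -/
@[simp] theorem normalize_var (x : X) : normalize (var x : HTerm K X) = var x := by rw [normalize]

/-- Normal form of a constant. [folklore] -/
@[simp] theorem normalize_const (c : K) : normalize (const c : HTerm K X) = const c := by
  rw [normalize]

/-- **Permuting the children does not change the normal form.** [folklore] -/
theorem normalize_node_perm (b : Bool) {l l' : List (HTerm K X)} (h : l.Perm l') :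
    normalize (node b l) = normalize (node b l') := by
  rw [normalize_node, normalize_node, tsort_eq_of_perm (h.map normalize)]

/-- Pointwise-equal normal forms of the children give equal normal forms. [folklore] -/
theorem normalize_node_congr (b : Bool) {l l' : List (HTerm K X)}
    (h : l.map normalize = l'.map normalize) : normalize (node b l) = normalize (node b l') := by
  rw [normalize_node, normalize_node, h]

/-- **The normal form is idempotent.** [folklore] -/
theorem normalize_normalize : ∀ t : HTerm K X, normalize (normalize t) = normalize t
  | var x => by simp
  | const c => by simp
  | node b l => by
    rw [normalize_node, normalize_node]
    congr 1
    have h1 : (List.map normalize (tsort (List.map normalize l))).Perm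
        (List.map normalize (List.map normalize l)) := (tsort_perm _).map normalize
    rw [List.map_map] at h1
    have h2 : List.map (normalize ∘ normalize) l = List.map normalize l :=
      List.map_congr_left fun t _ => normalize_normalize t
    rw [h2] at h1
    exact tsort_eq_of_perm h1

/-- **Normalisation does not change the value.** [folklore] -/
theorem val_normalize [CommSemiring K] : ∀ t : HTerm K X, (normalize t).val = t.val
  | var x => by simp
  | const c => by simp
  | node b l => by
    rw [normalize_node, val_node_perm b (tsort_perm _)]
    cases b
    · rw [val_node_false, val_node_false, List.map_map]
      congr 1
      exact List.map_congr_left fun t _ => val_normalize t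
    · rw [val_node_true, val_node_true, List.map_map]
      congr 1
      exact List.map_congr_left fun t _ => val_normalize t

/-- Normalisation does not change the size. [folklore] -/
theorem size_normalize : ∀ t : HTerm K X, (normalize t).size = t.size
  | var x => by simp
  | const c => by simp
  | node b l => by
    rw [normalize_node, size, size, sizeList_perm (tsort_perm _), sizeList_eq_sum, sizeList_eq_sum,
      List.map_map]
    congr 2
    exact List.map_congr_left fun t _ => size_normalize t

/-- **Renaming commutes with normalisation up to normalisation**:
`normalize (rename f (normalize t)) = normalize (rename f t)`. [folklore] -/
theorem normalize_rename_normalize (f : X → X) :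
    ∀ t : HTerm K X, normalize (rename f (normalize t)) = normalize (rename f t)
  | var x => by simp [rename]
  | const c => by simp [rename]
  | node b l => by
    rw [normalize_node b l, rename_node, rename_node, normalize_node, normalize_node, List.map_map,
      List.map_map]
    congr 1
    apply tsort_eq_of_perm
    have h1 : ((tsort (List.map normalize l)).map (normalize ∘ rename f)).Perm
        ((List.map normalize l).map (normalize ∘ rename f)) := (tsort_perm _).map _
    rw [List.map_map] at h1
    have h2 : List.map ((normalize ∘ rename f) ∘ normalize) l = List.map (normalize ∘ rename f) l :=
      List.map_congr_left fun t _ => normalize_rename_normalize f t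
    rw [h2] at h1
    exact h1

/-! ### The action of variable symmetries on normal forms -/

section Act

variable {Γ : Type*} [Group Γ] [MulAction Γ X]

/-- The action of `γ` on normal forms: rename by `γ` and renormalise. [folklore] -/
def act (γ : Γ) (t : HTerm K X) : HTerm K X := normalize (rename (fun x => γ • x) t)

/-- `act γ` lands in normal forms. [folklore] -/
theorem normalize_act (γ : Γ) (t : HTerm K X) : normalize (act γ t) = act γ t :=
  normalize_normalize _

/-- `act 1` is normalisation (the identity on normal forms). [folklore] -/
theorem act_one (t : HTerm K X) : act (1 : Γ) t = normalize t := by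
  have : (fun x : X => (1 : Γ) • x) = id := funext fun x => one_smul Γ x
  rw [act, this, rename_id]

/-- `act` is multiplicative on normal forms: `act (γ * δ) t = act γ (act δ t)`. [folklore] -/
theorem act_mul (γ δ : Γ) (t : HTerm K X) : act (γ * δ) t = act γ (act δ t) := by
  rw [act, act, act, normalize_rename_normalize, rename_comp]
  congr 2
  funext x
  exact mul_smul γ δ x

/-- `act γ` after normalisation is `act γ`. [folklore] -/
theorem act_normalize (γ : Γ) (t : HTerm K X) : act γ (normalize t) = act γ t :=
  normalize_rename_normalize _ t

/-- `act` is injective on normal forms. [folklore] -/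
theorem act_injective_of_normal (γ : Γ) {t t' : HTerm K X} (ht : normalize t = t)
    (ht' : normalize t' = t') (h : act γ t = act γ t') : t = t' := by
  have := congrArg (act γ⁻¹) h
  rwa [← act_mul, ← act_mul, inv_mul_cancel, act_one, act_one, ht, ht'] at this

/-- The value of `act γ t` is the renamed value. [folklore] -/
theorem val_act [CommSemiring K] (γ : Γ) (t : HTerm K X) :
    (act γ t).val = MvPolynomial.rename (fun x => γ • x) t.val := by
  rw [act, val_normalize, val_rename]

/-- `act γ` of a node is a node with the same label whose children are, as a multiset, the `act γ`
of the children. [folklore] -/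
theorem act_node (γ : Γ) (b : Bool) (l : List (HTerm K X)) :
    act γ (node b l) = node b (tsort (l.map (act γ))) := by
  rw [act, rename_node, normalize_node, List.map_map]
  rfl

/-- `act` preserves size. [folklore] -/
theorem size_act (γ : Γ) (t : HTerm K X) : (act γ t).size = t.size := by
  rw [act, size_normalize, size_rename]

end Act

end HTerm

end Summit.ValiantsHypothesis.ValiantsHypothesis.Theorems

end
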